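import Mathlib
import Summits.HodgeConjecture.FermatCycles.HodgeFermatThmFstarNStatement
import Summits.HodgeConjecture.FermatCycles.HodgeFermatThmFstar
import Summits.HodgeConjecture.FermatCycles.HodgeFermatBadVanishD
import Summits.HodgeConjecture.FermatCycles.HodgeFermatHypVRange
import Summits.HodgeConjecture.FermatCycles.HodgeFermatHypVTailC

/-!
# THEOREM F*(3N) at every admissible squarefree level `3N` — from `H0`, and unconditional (`HodgeFermat/ThmFstarN.lean`, `HodgeFermat/ThmFstarNFinal.lean`; HF-G33, final form)

Tree copy of the two modules `HodgeFermat/ThmFstarN.lean` (87 lines, sha256 `77c7c5c97fe676ff…`) and `HodgeFermat/ThmFstarNFinal.lean`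
(48 lines, sha256 `bcff3e9353883faa…`) of the sibling cell's standalone package `run/shared/lean/pub/pub-hodgefermat/lean/HodgeFermat/`,
and the closing file of the chain `HodgeFermatThmFstarNStatement` → (`HodgeFermatDecodingC` →) `HodgeFermatDecodingRingA/B` →
`HodgeFermatLemmaEGoodA/B` → (`HodgeFermatHypVDefs`,) `HodgeFermatBadVanishA/B/C/D`; `HodgeFermatHypUDefs` → `HodgeFermatHypUCertA/B` →
`HodgeFermatHypUAuto` → `HodgeFermatHypVCert` → `HodgeFermatHypVRange`; `HodgeFermatHypVDefs` → `HodgeFermatHypVTailA/B/C`, filed by cell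
`pub-hfermat`, seat prover-1 gen-2, on the COORDINATOR KEEPER RULING of 2026-08-25 (gem sweep H1: take the off-gate kernel theorem
`thmFstar` through the gate) — here its second namesake `ThmFstarNFinal.thmFstar`, THEOREM F*(3N) (the first, `DecodingFinal.thmFstar`,
THEOREM F* at the prime levels, landed as `HodgeFermatThmFstar.lean`, seat prover-1 gen-0).  The declarations of `ThmFstarN.lean` are
VERBATIM those of the cell record `check/ThmFstarN_standalone.lean` (21 bodies, 438 871 B, sha256 ced731ec52c92191…, hub `lean check`
rc 0, 222.2 s, `--axioms …ThmFstarN.thmFstarN` = [propext, Classical.choice, Quot.sound]; pub-hodgefermat `CERT.md` l.987, GATE HF-G33);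
`ThmFstarNFinal.lean` is the sibling's «lake-only» composition with `HurwitzZero.hypH0` (shape validated on the hub).

Deviations from the source modules, exhaustively: the `import` lines; this module docstring; the two modules in ONE file (two
namespaces, source order); in the `ThmFstarNFinal` part the source's `theorem h0 : H0 := HodgeFermat.KRFree.HurwitzZero.hypH0`
(l.23–24) is NOT re-declared — it is, statement and content, the landed `HodgeFermat.KRFree.DecodingFinal.h0` of
`HodgeFermatThmFstar.lean` (proved there from `HurwitzZero.hurwitzZeta_zero`, i.e. by `hypH0`'s own one-line term, so that the
17-module analytic D6 chain `HypBReduction` is not imported), brought into scope by `open HodgeFermat.KRFree.DecodingFinal (h0)` so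
that the two use sites stay byte-identical; in the `ThmFstarN` part ONE token of the proof of `thmFstarN` differs — the prime
case `exact LemmaEGood.thmFstar_prime h0 hp hn11 hn13 …` (source `ThmFstarN.lean` l.64) now reads `exact Decoding.thmFstar h0 hp
hn11 hn13 …`: the sibling's `LemmaEGood.thmFstar_prime` (a consistency re-derivation of THEOREM F*(3p) through `thmFstar_of_bad`)
has, by design, exactly the statement of the landed `HodgeFermat.KRFree.Decoding.thmFstar` (`HodgeFermatDecodingC.lean`) and was
therefore not filed (gate dedup; `HodgeFermatLemmaEGoodB.lean`), so the prime case invokes the landed theorem directly (same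
argument list); and the NEW closing theorem `thmFstarN_holds : ThmFstarN` (the statement filed first,
count-neutral, in `HodgeFermatThmFstarNStatement.lean`), a re-packaging of `ThmFstarNFinal.thmFstar` with no mathematical content.
Every other line — in particular the statements of all seven theorems and the proofs of `hypV`, `le_of_composite`,
`ineqV_of_composite`, `thmFstarN'`, `thmFstar`, `thmFstar'` — is byte-identical to the sources (`ThmFstarN.lean` l.28–87,
`ThmFstarNFinal.lean` l.19–21, 26–48).

Trust base: no hypotheses, no `sorry`; axioms of `thmFstar` / `thmFstarN_holds` = [propext, Classical.choice, Quot.sound] (Mathlib's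
Dirichlet `L(χ, 1) ≠ 0`, the Hurwitz zeta functional equation, thirty-one `decide +kernel` evaluations of the walk `HypVCert.walkV` /
`checkLevelV` (no `native_decide`, no `ofReduceBool`), and the files above).
HONEST FRAMING: explicit algebraic cycles for specific Hodge classes on Fermat/Delsarte varieties; residual open instances
listed; no claim on general Hodge.  (THEOREM F*(3N) is arithmetic of CM types of Fermat-curve triples at level `3N`; it is the
decoding step of the sibling's analysis of the Hodge gap groups `G_{3N}` — DOOR.md §0 of this cell — and claims nothing about cycles.)

The docstring of the source module `ThmFstarN.lean` (l.8–26), verbatim: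

## THEOREM F*(3N) at every admissible squarefree level — from H0 (HF-G33)

`thmFstarN`: let `N ≥ 11`, `N ≠ 13` be SQUAREFREE with all prime factors `≥ 11` (i.e. prime to `210`), and let
`(a, b, c)`, `(a′, b′, c′)` be zero-sum triples mod `3N` with all entries prime to `N`, DISJOINT mod `3N`.  Then they do
not have the same CM type at level `3N` (`LemmaN.SameType`).  Hypothesis: the Hurwitz value `H0` only (discharged by
`HurwitzZero.hypH0` in the lake-only `ThmFstarNFinal.lean`).

Assembly of generation 33:
* prime `N`: `LemmaEGood.thmFstar_prime` (generation 32; the Bad coefficients are vacuous);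
* composite `N` (then `N ≥ 121`): `BadVanish.thmFstar_of_ineq` — the Bad coefficients of DPRIME §7.2–7.4 vanish by the
  uncertainty principle on `(ℤ/N)ˣ` as soon as `IneqV N : 12 + 12 Σ_{q ∣ N} tauV N q < φ(N)` — and HYPOTHESIS V
  `hypV : HypV` (every squarefree `N ≥ 25` prime to `210` satisfies `IneqV N`): the kernel walk `HypVRange.vRange`
  (`N ≤ 30000`) and the tail `HypVTail.vTail` (`N > 30000`, given the walk-certified level `46189`,
  `HypVCert.ineqV_46189`), glued by `HypVDefs.hypV_of_range_tail`.

Hub record `check/ThmFstarN_standalone.lean` (21 bodies) + the split pair `check/ThmFstarN_link_standalone.lean`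
(the 30 kernel-walk chunks `HypVRange.w_i` admitted) / `check/HypVRange_standalone.lean` (proves them).

The docstring of the source module `ThmFstarNFinal.lean` (l.7–17), verbatim:

## THEOREM F*(3N) at every admissible squarefree level — unconditional (HF-G33, final form)

`HodgeFermat/ThmFstarN.lean` proves THEOREM F* of `tables/DPRIME-THEOREM.md` §9 at the level `3N` for every SQUAREFREE
`N ≥ 11`, `N ≠ 13` with all prime factors `≥ 11`, from the Hurwitz special value `H0` (`ζ(0, x) = 1/2 − x`).
`HodgeFermat/HurwitzZero.lean` (generation 23) proves `H0` (`hypH0 : HypBReduction.HypH0`, the same term as `LemmaEMu.H0`;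
cf. `DecodingFinal.h0`).  This module puts them together: the hypothesis-free `thmFstar`.  Heavy import (the analytic
chain); LAKE-ONLY — the union of the two import cones exceeds the hub's one-file cap, exactly as for `DPrimePrimeFinal`
(generation 32, lesson (xxi)); the composition SHAPE is validated on the hub by the seat scratch `scratch/ShapeFinal.lean`.
NOT imported by the root `HodgeFermat.lean`.
-/

set_option autoImplicit false

namespace HodgeFermat.KRFree.ThmFstarN

open HodgeFermat.KRFree.LemmaN HodgeFermat.KRFree.LemmaEMu HodgeFermat.KRFree.HypVDefs

/-- **HYPOTHESIS V** (unconditional): `12 + 12 Σ_{q ∣ N} φ(N/q)/ord_{N/q}(q) < φ(N)` for every squarefree `N ≥ 25`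
prime to `210`. -/
theorem hypV : HypV :=
  hypV_of_range_tail (X := 30000) HypVRange.vRange (HypVTail.vTail HypVCert.ineqV_46189)

/-- a composite number all of whose prime factors are `≥ 11` is `≥ 121` -/
theorem le_of_composite {N : ℕ} (h1 : 1 < N) (hnp : ¬ N.Prime) (h11 : ∀ p ∈ N.primeFactors, 11 ≤ p) :
    121 ≤ N := by
  have hmin : 11 ≤ N.minFac :=
    h11 _ (Nat.mem_primeFactors.mpr ⟨Nat.minFac_prime (by omega), Nat.minFac_dvd N, by omega⟩)
  have hsq : N.minFac ^ 2 ≤ N := Nat.minFac_sq_le_self (by omega) hnp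
  nlinarith

/-- `IneqV N` at every composite squarefree `N > 1` with all prime factors `≥ 11` (from `hypV`). -/
theorem ineqV_of_composite {N : ℕ} (h1 : 1 < N) (hnp : ¬ N.Prime) (hsq : Squarefree N)
    (h11 : ∀ p ∈ N.primeFactors, 11 ≤ p) : IneqV N := by
  obtain ⟨h2, h3, h5, h7⟩ := cop210_of_primeFactors (by omega) h11
  exact hypV N (le_trans (by norm_num) (le_of_composite h1 hnp h11)) hsq h2 h3 h5 h7

/-- **THEOREM F\*(3N), every admissible squarefree level (from H0).**  `N ≥ 11`, `N ≠ 13` squarefree with all prime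
factors `≥ 11`; `(a, b, c)`, `(a′, b′, c′)` zero-sum triples mod `3N` with entries prime to `N`, disjoint mod `3N`
(no entry of the first congruent to an entry of the second): they do not have the same CM type at level `3N`. -/
theorem thmFstarN (h0 : H0) {N : ℕ} (hn11 : 11 ≤ N) (hn13 : N ≠ 13) (hsq : Squarefree N)
    (h11 : ∀ p ∈ N.primeFactors, 11 ≤ p) {a b c a' b' c' : ℕ}
    (hs : 3 * N ∣ a + b + c) (hs' : 3 * N ∣ a' + b' + c')
    (ha : Nat.Coprime a N) (hb : Nat.Coprime b N) (hc : Nat.Coprime c N)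
    (ha' : Nat.Coprime a' N) (hb' : Nat.Coprime b' N) (hc' : Nat.Coprime c' N)
    (hD : ∀ u v, (u = a ∨ u = b ∨ u = c) → (v = a' ∨ v = b' ∨ v = c') → ¬ u ≡ v [MOD 3 * N])
    (hT : SameType (3 * N) (a, b, c) (a', b', c')) : False := by
  by_cases hp : N.Prime
  · exact Decoding.thmFstar h0 hp hn11 hn13 hs hs' ha hb hc ha' hb' hc' hD hT
  · haveI : NeZero N := ⟨by omega⟩
    have h3N : ¬ 3 ∣ N := fun h =>
      absurd (h11 3 (Nat.mem_primeFactors.mpr ⟨Nat.prime_three, h, by omega⟩)) (by norm_num)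
    exact BadVanish.thmFstar_of_ineq h0 hn11 h3N hn13 hsq (ineqV_of_composite (by omega) hp hsq h11)
      hs hs' ha hb hc ha' hb' hc' hD hT

/-- The same with the coprimality-to-`210` hypotheses in divisibility form. -/
theorem thmFstarN' (h0 : H0) {N : ℕ} (hn11 : 11 ≤ N) (hn13 : N ≠ 13) (hsq : Squarefree N)
    (h2 : ¬ 2 ∣ N) (h3 : ¬ 3 ∣ N) (h5 : ¬ 5 ∣ N) (h7 : ¬ 7 ∣ N) {a b c a' b' c' : ℕ}
    (hs : 3 * N ∣ a + b + c) (hs' : 3 * N ∣ a' + b' + c')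
    (ha : Nat.Coprime a N) (hb : Nat.Coprime b N) (hc : Nat.Coprime c N)
    (ha' : Nat.Coprime a' N) (hb' : Nat.Coprime b' N) (hc' : Nat.Coprime c' N)
    (hD : ∀ u v, (u = a ∨ u = b ∨ u = c) → (v = a' ∨ v = b' ∨ v = c') → ¬ u ≡ v [MOD 3 * N])
    (hT : SameType (3 * N) (a, b, c) (a', b', c')) : False := by
  refine thmFstarN h0 hn11 hn13 hsq (fun p hp => ?_) hs hs' ha hb hc ha' hb' hc' hD hT
  obtain ⟨hpr, hdvd, -⟩ := Nat.mem_primeFactors.mp hp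
  have hp2 : ¬ 2 ∣ p := fun h => h2 (dvd_trans h hdvd)
  have hp3 : ¬ 3 ∣ p := fun h => h3 (dvd_trans h hdvd)
  have hp5 : ¬ 5 ∣ p := fun h => h5 (dvd_trans h hdvd)
  have hp7 : ¬ 7 ∣ p := fun h => h7 (dvd_trans h hdvd)
  exact HypVTail.eleven_le hpr hp2 hp3 hp5 hp7

end HodgeFermat.KRFree.ThmFstarN

namespace HodgeFermat.KRFree.ThmFstarNFinal

open HodgeFermat.KRFree.LemmaN HodgeFermat.KRFree.LemmaEMu

open HodgeFermat.KRFree.DecodingFinal (h0)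

-- `h0 : H0` (source l.23–24, `:= HodgeFermat.KRFree.HurwitzZero.hypH0`): NOT re-declared — it is the landed
-- `HodgeFermat.KRFree.DecodingFinal.h0` (`HodgeFermatThmFstar.lean`), opened above.

/-- **THEOREM F\*(3N) — unconditional.**  Let `N ≥ 11`, `N ≠ 13` be squarefree with all prime factors `≥ 11` and let
`(a, b, c)`, `(a′, b′, c′)` be zero-sum triples mod `3N` with all entries prime to `N`, DISJOINT mod `3N`.  Then they do
not have the same CM type at level `3N` (`LemmaN.SameType`). -/
theorem thmFstar {N : ℕ} (hn11 : 11 ≤ N) (hn13 : N ≠ 13) (hsq : Squarefree N)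
    (h11 : ∀ p ∈ N.primeFactors, 11 ≤ p) {a b c a' b' c' : ℕ}
    (hs : 3 * N ∣ a + b + c) (hs' : 3 * N ∣ a' + b' + c')
    (ha : Nat.Coprime a N) (hb : Nat.Coprime b N) (hc : Nat.Coprime c N)
    (ha' : Nat.Coprime a' N) (hb' : Nat.Coprime b' N) (hc' : Nat.Coprime c' N)
    (hD : ∀ u v, (u = a ∨ u = b ∨ u = c) → (v = a' ∨ v = b' ∨ v = c') → ¬ u ≡ v [MOD 3 * N])
    (hT : SameType (3 * N) (a, b, c) (a', b', c')) : False :=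
  ThmFstarN.thmFstarN h0 hn11 hn13 hsq h11 hs hs' ha hb hc ha' hb' hc' hD hT

/-- divisibility form of the level hypothesis -/
theorem thmFstar' {N : ℕ} (hn11 : 11 ≤ N) (hn13 : N ≠ 13) (hsq : Squarefree N)
    (h2 : ¬ 2 ∣ N) (h3 : ¬ 3 ∣ N) (h5 : ¬ 5 ∣ N) (h7 : ¬ 7 ∣ N) {a b c a' b' c' : ℕ}
    (hs : 3 * N ∣ a + b + c) (hs' : 3 * N ∣ a' + b' + c')
    (ha : Nat.Coprime a N) (hb : Nat.Coprime b N) (hc : Nat.Coprime c N)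
    (ha' : Nat.Coprime a' N) (hb' : Nat.Coprime b' N) (hc' : Nat.Coprime c' N)
    (hD : ∀ u v, (u = a ∨ u = b ∨ u = c) → (v = a' ∨ v = b' ∨ v = c') → ¬ u ≡ v [MOD 3 * N])
    (hT : SameType (3 * N) (a, b, c) (a', b', c')) : False :=
  ThmFstarN.thmFstarN' h0 hn11 hn13 hsq h2 h3 h5 h7 hs hs' ha hb hc ha' hb' hc' hD hT

/-- **THEOREM F\*(3N) at every admissible squarefree level, as filed** (`HodgeFermatThmFstarNStatement.lean`): `ThmFstarN`
holds — for every squarefree `N ≥ 11`, `N ≠ 13` all of whose prime factors are `≥ 11`, two zero-sum triples mod `3N` with all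
entries prime to `N` and DISJOINT mod `3N` do not have the same CM type at level `3N`.  Unconditional; this is `thmFstar` with its
binders packaged as the `Prop` `ThmFstarN`. -/
theorem thmFstarN_holds : ThmFstarN :=
  fun _ hn11 hn13 hsq h11 _ _ _ _ _ _ hs hs' ha hb hc ha' hb' hc' hD hT =>
    thmFstar hn11 hn13 hsq h11 hs hs' ha hb hc ha' hb' hc' hD hT

end HodgeFermat.KRFree.ThmFstarNFinal
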